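import Summits.CriticalPhenomena.PercolationContinuityZ3.Theorems.PercNearOneGluingNoHeavyPcintWinKernelSym
import Summits.CriticalPhenomena.PercolationContinuityZ3.Theorems.PercNearOneGluingNoHeavyPcintWinKernelCert
import HarnessLib

/-!
# PCINT lane, kernel window certificates modulo the hyperoctahedral group — rows on normal forms suffice

Cell `prim-pcint`, seat `prim-pcint-2` (gen 2); memo `run/shared/lean/prim/pcint/REDUCTIONS.md` §R2, INTERVAL-PLAN §14.
Does NOT build on p205010.  With the invariance results of `…PcintWinKernelSym`:
* `gramCode` — an invariant key of a window (the Gram data of its steps: same axis / same sign), and the table lookup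
  `lookupK` / `vK` keyed by it (`lookupK_actW`: invariant);
* the scaled rows `rowBK`, `rowSK` (as `rowB`, `rowS` of `…PcintWinKernelCert`, with `vK`) and their invariance
  under the action (`rowBK_actW`, `rowSK_actW`: reindex the successor steps by `actStepEquiv`);
* the per-code checks `nfOKB`, `nfOKS`: the Collatz–Wielandt row is required ONLY for codes whose window is in
  first-use normal form (`isNF`);
* **`le_criticalProb_of_checkBK`**, **`le_siteCriticalProb_of_checkSK`**: the normal-form check on all codes
  `< (2d)^{m+1}` plus the integer side conditions give `pn/10^4 ≤ p_c^bond(ℤ^d)` resp. `p_c^site(ℤ^d)` — every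
  window has a normal form in its orbit (`exists_isNF_actW`) and the rows are orbit-constant.
-/

namespace Summit.CriticalPhenomena.PercolationContinuityZ3.Theorems.Pcint

open Finset Literature.Probability.Percolation Literature.Probability.LatticeModels

namespace WinK

variable {d m : ℕ}

/-! ### An invariant key and the table lookup keyed by it -/

/-- Gram digit of two steps: `1` same axis and sign, `2` same axis opposite sign, `0` different axes. [folklore] -/
def gramDigit (a b : Fin d × Bool) : ℕ := if a.1 = b.1 then (if a.2 = b.2 then 1 else 2) else 0

/-- The Gram digits are invariant under signed permutations. [folklore] -/
theorem gramDigit_actStep (g : SPerm d) (a b : Fin d × Bool) :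
    gramDigit (actStep g a) (actStep g b) = gramDigit a b := by
  obtain ⟨i, x⟩ := a
  obtain ⟨j, y⟩ := b
  simp only [gramDigit, actStep, g.1.injective.eq_iff]
  by_cases hij : i = j
  · subst hij
    rcases Bool.eq_false_or_eq_true (g.2 i) with h | h <;> cases x <;> cases y <;> simp [h]
  · simp [hij]

/-- Base-3 code of the Gram matrix of a window. [folklore] -/
def gramCode {n : ℕ} (w : Fin n → Fin d × Bool) : ℕ :=
  ((List.finRange n).flatMap fun i => (List.finRange n).map fun j => gramDigit (w i) (w j)).foldr
    (fun dg acc => dg + 3 * acc) 0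

/-- The Gram code is invariant. [folklore] -/
theorem gramCode_actW (g : SPerm d) {n : ℕ} (w : Fin n → Fin d × Bool) : gramCode (actW g w) = gramCode w := by
  simp only [gramCode, actW, gramDigit_actStep]

/-- Table lookup of a certificate value by Gram code (default for codes not in the table). [folklore] -/
def lookupK {n : ℕ} (tbl : List (ℕ × ℕ)) (dflt : ℕ) (u : Fin n → Fin d × Bool) : ℕ :=
  ((tbl.find? fun e => e.1 = gramCode u).map fun e => e.2).getD dflt

/-- The keyed lookup is invariant. [folklore] -/
theorem lookupK_actW {n : ℕ} (tbl : List (ℕ × ℕ)) (dflt : ℕ) (g : SPerm d) (u : Fin n → Fin d × Bool) :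
    lookupK tbl dflt (actW g u) = lookupK tbl dflt u := by
  simp only [lookupK, gramCode_actW]

/-- Bounds of a keyed lookup. [folklore] -/
theorem lookupK_bounds {n : ℕ} {tbl : List (ℕ × ℕ)} {dflt lo hi : ℕ} (htbl : ∀ e ∈ tbl, lo ≤ e.2 ∧ e.2 ≤ hi)
    (hdflt : lo ≤ dflt ∧ dflt ≤ hi) (u : Fin n → Fin d × Bool) : lo ≤ lookupK tbl dflt u ∧ lookupK tbl dflt u ≤ hi := by
  unfold lookupK
  cases h : (tbl.find? fun e => e.1 = gramCode u) with
  | none => simpa using hdflt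
  | some e =>
    simp only [Option.map_some, Option.getD_some]
    exact htbl e (List.mem_of_find?_eq_some h)

/-- The action on steps is a bijection. [folklore] -/
def actStepEquiv (g : SPerm d) : (Fin d × Bool) ≃ (Fin d × Bool) where
  toFun := actStep g
  invFun := fun b => (g.1.symm b.1, xor b.2 (g.2 (g.1.symm b.1)))
  left_inv := fun a => by
    obtain ⟨i, x⟩ := a
    simp only [actStep, Equiv.symm_apply_apply, Prod.mk.injEq, true_and]
    cases x <;> cases g.2 i <;> rfl
  right_inv := fun b => by
    obtain ⟨j, y⟩ := b
    simp only [actStep, Equiv.apply_symm_apply, Prod.mk.injEq, true_and]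
    cases y <;> cases g.2 (g.1.symm j) <;> rfl

/-! ### Rows with keyed values, and normal-form checks -/

section Rows

variable (d m pn R S Q lamN : ℕ) (tbl : List (ℕ × ℕ)) (dflt : ℕ)

/-- Certificate value of a window (table keyed by the Gram code). [folklore] -/
def vK (u : Fin (m + 1) → Fin d × Bool) : ℕ := lookupK tbl dflt u

/-- One summand of the scaled B3r row (keyed values), on the one-pass site list. [folklore] -/
def rowTermBK (u : Fin (m + 1) → Fin d × Bool) (a : Fin d × Bool) : ℕ :=
  let ps := sitesF u a
  if okcF ps then termB pn R S (m + 1) (2 * d) (ccF m ps) (gNF d m ps) (cNF d m ps a) * vK d m tbl dflt (wshift u a) else 0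

/-- One summand of the scaled B2r row (keyed values), on the one-pass site list. [folklore] -/
def rowTermSK (u : Fin (m + 1) → Fin d × Bool) (a : Fin d × Bool) : ℕ :=
  let ps := sitesF u a
  if okNF m ps then termS pn Q (2 * d) (gNF d m ps) (cNF d m ps a) * vK d m tbl dflt (wshift u a) else 0

/-- The B3r summand in terms of the reference tests. [folklore] -/
theorem rowTermBK_eq (u : Fin (m + 1) → Fin d × Bool) (a : Fin d × Bool) :
    rowTermBK d m pn R S tbl dflt u a =
      if okc u a then termB pn R S (m + 1) (2 * d) (cc u a) (gN u a) (cN u a) * vK d m tbl dflt (wshift u a) else 0 := by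
  simp only [rowTermBK, sitesF_eq_sites, okcF_eq, ccF_eq, gNF_eq, cNF_eq]

/-- The B2r summand in terms of the reference tests. [folklore] -/
theorem rowTermSK_eq (u : Fin (m + 1) → Fin d × Bool) (a : Fin d × Bool) :
    rowTermSK d m pn Q tbl dflt u a =
      if okN u a then termS pn Q (2 * d) (gN u a) (cN u a) * vK d m tbl dflt (wshift u a) else 0 := by
  simp only [rowTermSK, sitesF_eq_sites, okNF_eq, gNF_eq, cNF_eq]

/-- Scaled B3r row (keyed values). [folklore] -/
def rowBK (u : Fin (m + 1) → Fin d × Bool) : ℕ := ∑ a : Fin d × Bool, rowTermBK d m pn R S tbl dflt u a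

/-- Scaled B2r row (keyed values). [folklore] -/
def rowSK (u : Fin (m + 1) → Fin d × Bool) : ℕ := ∑ a : Fin d × Bool, rowTermSK d m pn Q tbl dflt u a

/-- B3r row check on one code. [folklore] -/
def rowOKBK [NeZero d] (c : ℕ) : Bool :=
  decide (10 ^ 5 * rowBK d m pn R S tbl dflt (decodeW d (m + 1) c) ≤ lamN * denB d m * vK d m tbl dflt (decodeW d (m + 1) c))

/-- B2r row check on one code. [folklore] -/
def rowOKSK [NeZero d] (c : ℕ) : Bool :=
  decide (10 ^ 5 * rowSK d m pn Q tbl dflt (decodeW d (m + 1) c) ≤ lamN * denS d * vK d m tbl dflt (decodeW d (m + 1) c))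

/-- B3r check on one code, required only in first-use normal form. [folklore] -/
def nfOKB [NeZero d] (c : ℕ) : Bool := !(isNF (decodeW d (m + 1) c)) || rowOKBK d m pn R S lamN tbl dflt c

/-- B2r check on one code, required only in first-use normal form. [folklore] -/
def nfOKS [NeZero d] (c : ℕ) : Bool := !(isNF (decodeW d (m + 1) c)) || rowOKSK d m pn Q lamN tbl dflt c

variable {d m pn R S Q lamN tbl dflt}

/-- The keyed value is invariant. [folklore] -/
theorem vK_actW (g : SPerm d) (u : Fin (m + 1) → Fin d × Bool) : vK d m tbl dflt (actW g u) = vK d m tbl dflt u :=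
  lookupK_actW tbl dflt g u

/-- The B3r summand is invariant. [folklore] -/
theorem rowTermBK_actW (g : SPerm d) (u : Fin (m + 1) → Fin d × Bool) (a : Fin d × Bool) :
    rowTermBK d m pn R S tbl dflt (actW g u) (actStep g a) = rowTermBK d m pn R S tbl dflt u a := by
  rw [rowTermBK_eq, rowTermBK_eq, okc_actW, cc_actW, gN_actW, cN_actW, wshift_actW, vK_actW]

/-- The B2r summand is invariant. [folklore] -/
theorem rowTermSK_actW (g : SPerm d) (u : Fin (m + 1) → Fin d × Bool) (a : Fin d × Bool) :
    rowTermSK d m pn Q tbl dflt (actW g u) (actStep g a) = rowTermSK d m pn Q tbl dflt u a := by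
  rw [rowTermSK_eq, rowTermSK_eq, okN_actW, gN_actW, cN_actW, wshift_actW, vK_actW]

/-- **The B3r row is orbit-constant.** [folklore] -/
theorem rowBK_actW (g : SPerm d) (u : Fin (m + 1) → Fin d × Bool) :
    rowBK d m pn R S tbl dflt (actW g u) = rowBK d m pn R S tbl dflt u := by
  unfold rowBK
  rw [← Fintype.sum_equiv (actStepEquiv g) (fun a => rowTermBK d m pn R S tbl dflt (actW g u) (actStep g a))
    (fun b => rowTermBK d m pn R S tbl dflt (actW g u) b) (fun _ => rfl)]
  exact Fintype.sum_congr _ _ fun a => rowTermBK_actW g u a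

/-- **The B2r row is orbit-constant.** [folklore] -/
theorem rowSK_actW (g : SPerm d) (u : Fin (m + 1) → Fin d × Bool) :
    rowSK d m pn Q tbl dflt (actW g u) = rowSK d m pn Q tbl dflt u := by
  unfold rowSK
  rw [← Fintype.sum_equiv (actStepEquiv g) (fun a => rowTermSK d m pn Q tbl dflt (actW g u) (actStep g a))
    (fun b => rowTermSK d m pn Q tbl dflt (actW g u) b) (fun _ => rfl)]
  exact Fintype.sum_congr _ _ fun a => rowTermSK_actW g u a

end Rows

/-! ### The two generic bound theorems, normal-form version -/

/-- **Kernel B3r certificate on normal forms ⇒ `pn/10^4 ≤ p_c^bond(ℤ^d)`** (side conditions as in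
`le_criticalProb_of_checkB`; the row check is required only on codes of windows in first-use normal form). [folklore] -/
theorem le_criticalProb_of_checkBK {d m pn R S lamN : ℕ} [NeZero d] {tbl : List (ℕ × ℕ)} {dflt vlo vhi : ℕ}
    (hpn : pn ≤ 10 ^ 4) (hS : 10 ^ 8 ≤ S ^ 2 + pn ^ 2) (hS1 : S ≤ 10 ^ 4) (hS0 : 0 < S) (hR : 10 ^ 8 ≤ S * R)
    (hpr : (10 ^ 4 - pn) * R ≤ 10 ^ 8) (hlam0 : 0 < lamN) (hlam : lamN < 10 ^ 5)
    (htbl : ∀ e ∈ tbl, vlo ≤ e.2 ∧ e.2 ≤ vhi) (hdflt : vlo ≤ dflt ∧ dflt ≤ vhi) (hvlo : 0 < vlo)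
    (hcheck : allRange (nfOKB d m pn R S lamN tbl dflt) 0 ((2 * d) ^ (m + 1)) = true) :
    (pn : ℝ) / 10 ^ 4 ≤ criticalProb (zdGraph d) 0 := by
  have hp0 : (0 : ℝ) ≤ (pn : ℝ) / 10 ^ 4 := by positivity
  have hp1 : (pn : ℝ) / 10 ^ 4 ≤ 1 := by
    rw [div_le_one (by positivity)]; exact_mod_cast hpn
  set p : unitInterval := ⟨(pn : ℝ) / 10 ^ 4, hp0, hp1⟩ with hpdef
  have hpc : (p : ℝ) = (pn : ℝ) / 10 ^ 4 := rfl
  -- real forms of the integer side conditions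
  have hSr : (10 : ℝ) ^ 8 ≤ (S : ℝ) ^ 2 + (pn : ℝ) ^ 2 := by exact_mod_cast hS
  have hRr : (10 : ℝ) ^ 8 ≤ (S : ℝ) * R := by exact_mod_cast hR
  have hprr : ((10 ^ 4 - pn : ℕ) : ℝ) * R ≤ 10 ^ 8 := by exact_mod_cast hpr
  rw [Nat.cast_sub hpn] at hprr
  simp only [Nat.cast_pow, Nat.cast_ofNat] at hprr
  have hS0r : (0 : ℝ) < S := by exact_mod_cast hS0
  have hs0 : (0 : ℝ) < (S : ℝ) / 10 ^ 4 := by positivity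
  have hsb1 : (S : ℝ) / 10 ^ 4 ≤ 1 := by rw [div_le_one (by positivity)]; exact_mod_cast hS1
  have hκb : (1 + (S : ℝ) / 10 ^ 4) / 2 ≤ ((10 ^ 4 + S : ℕ) : ℝ) / 20000 := by
    apply le_of_eq; simp only [Nat.cast_add, Nat.cast_pow, Nat.cast_ofNat]; ring
  have hps : 1 - (p : ℝ) ^ 2 ≤ ((S : ℝ) / 10 ^ 4) ^ 2 := by
    rw [hpc]
    have h2 : (1 : ℝ) ≤ ((S : ℝ) ^ 2 + (pn : ℝ) ^ 2) / 10 ^ 8 := by rw [le_div_iff₀ (by positivity)]; linarith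
    have h3 : ((S : ℝ) / 10 ^ 4) ^ 2 + ((pn : ℝ) / 10 ^ 4) ^ 2 = ((S : ℝ) ^ 2 + (pn : ℝ) ^ 2) / 10 ^ 8 := by ring
    linarith
  have hsr : 1 ≤ (S : ℝ) / 10 ^ 4 * ((R : ℝ) / 10 ^ 4) := by
    rw [div_mul_div_comm, le_div_iff₀ (by positivity)]; linarith
  have hpr' : (1 - (p : ℝ)) * ((R : ℝ) / 10 ^ 4) ≤ 1 := by
    rw [hpc]
    have : (1 - (pn : ℝ) / 10 ^ 4) * ((R : ℝ) / 10 ^ 4) = ((10 ^ 4 - (pn : ℝ)) * R) / 10 ^ 8 := by ring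
    rw [this, div_le_one (by positivity)]; exact hprr
  have hvlo' : (0 : ℝ) < vlo := by exact_mod_cast hvlo
  have hlamr : (0 : ℝ) < lamN := by exact_mod_cast hlam0
  have hlam0' : (0 : ℝ) < (lamN : ℝ) / 10 ^ 5 := by positivity
  have hlam1' : (lamN : ℝ) / 10 ^ 5 < 1 := by rw [div_lt_one (by positivity)]; exact_mod_cast hlam
  -- every window satisfies its scaled row inequality
  have hrowN : ∀ u : Fin (m + 1) → Fin d × Bool,
      10 ^ 5 * rowBK d m pn R S tbl dflt u ≤ lamN * denB d m * vK d m tbl dflt u := by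
    intro u
    obtain ⟨g, hg⟩ := exists_isNF_actW u
    have h1 := forall_of_allRange hcheck (actW g u)
    rw [nfOKB, decodeW_encW, hg, Bool.not_true, Bool.false_or, rowOKBK, decodeW_encW, decide_eq_true_eq,
      rowBK_actW, vK_actW] at h1
    exact h1
  rw [← hpc]
  refine le_criticalProb_zd_of_chordRandWindowCert (m := m) ((⟨0, NeZero.pos d⟩ : Fin d), true) okc cc gN cN hok hc
    (fun u a _ => hgN u a) (fun u a _ => hcN u a) p (s := (S : ℝ) / 10 ^ 4) (sb := (S : ℝ) / 10 ^ 4)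
    (κb := ((10 ^ 4 + S : ℕ) : ℝ) / 20000) (r := (R : ℝ) / 10 ^ 4) hs0 le_rfl hsb1 hκb hps (by positivity) hsr hpr'
    (fun u => (vK d m tbl dflt u : ℝ)) (vmin := vlo) (vmax := vhi) (lam := (lamN : ℝ) / 10 ^ 5) hvlo'
    (fun u => by exact_mod_cast (lookupK_bounds htbl hdflt u).1)
    (fun u => by exact_mod_cast (lookupK_bounds htbl hdflt u).2) hlam0' hlam1' fun u => ?_
  have hden : (0 : ℝ) < (denB d m : ℝ) := by unfold denB; positivity
  have hN : ((10 ^ 5 * rowBK d m pn R S tbl dflt u : ℕ) : ℝ) ≤ ((lamN * denB d m * vK d m tbl dflt u : ℕ) : ℝ) := by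
    exact_mod_cast hrowN u
  push_cast at hN
  -- the real row is the scaled row over the denominator
  have hrow : (∑ a : Fin d × Bool, if okc u a then
      (p : ℝ) * (((1 - p) * ((R : ℝ) / 10 ^ 4)) ^ cc u a *
        (((S : ℝ) / 10 ^ 4) ^ gN u a * (if cN u a then ((10 ^ 4 + S : ℕ) : ℝ) / 20000 else 1))) *
        (vK d m tbl dflt (wshift u a) : ℝ) else 0) * (denB d m : ℝ) ≤ (rowBK d m pn R S tbl dflt u : ℝ) := by
    rw [rowBK, Nat.cast_sum, Finset.sum_mul]
    refine Finset.sum_le_sum fun a _ => le_of_eq ?_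
    rw [rowTermBK_eq]
    by_cases h : okc u a = true
    · simp only [h, if_true]
      rw [hpc, Nat.cast_mul, ← weightB_mul_den hpn (cc_le u a) (gN_le u a) (cN u a), denB]
      push_cast; ring
    · simp [h]
  rw [← le_div_iff₀ hden] at hrow
  refine hrow.trans ?_
  rw [div_le_iff₀ hden]
  linarith [hN]

/-- **Kernel B2r certificate on normal forms ⇒ `pn/10^4 ≤ p_c^site(ℤ^d)`** (side conditions as in
`le_siteCriticalProb_of_checkS`). [folklore] -/
theorem le_siteCriticalProb_of_checkSK {d m pn Q lamN : ℕ} [NeZero d] {tbl : List (ℕ × ℕ)} {dflt vlo vhi : ℕ}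
    (hpn : pn ≤ 10 ^ 4) (hQ1 : Q ≤ 10 ^ 4) (hQ : (10 ^ 4 - pn) * 10 ^ (4 * (2 * d - 1)) ≤ Q ^ (2 * d - 1) * 10 ^ 4)
    (hlam0 : 0 < lamN) (hlam : lamN < 10 ^ 5)
    (htbl : ∀ e ∈ tbl, vlo ≤ e.2 ∧ e.2 ≤ vhi) (hdflt : vlo ≤ dflt ∧ dflt ≤ vhi) (hvlo : 0 < vlo)
    (hcheck : allRange (nfOKS d m pn Q lamN tbl dflt) 0 ((2 * d) ^ (m + 1)) = true) :
    (pn : ℝ) / 10 ^ 4 ≤ siteCriticalProb (zdGraph d) 0 := by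
  have hp0 : (0 : ℝ) ≤ (pn : ℝ) / 10 ^ 4 := by positivity
  have hp1 : (pn : ℝ) / 10 ^ 4 ≤ 1 := by
    rw [div_le_one (by positivity)]; exact_mod_cast hpn
  set p : unitInterval := ⟨(pn : ℝ) / 10 ^ 4, hp0, hp1⟩ with hpdef
  have hpc : (p : ℝ) = (pn : ℝ) / 10 ^ 4 := rfl
  have hq0 : (0 : ℝ) ≤ (Q : ℝ) / 10 ^ 4 := by positivity
  have hqb1 : (Q : ℝ) / 10 ^ 4 ≤ 1 := by rw [div_le_one (by positivity)]; exact_mod_cast hQ1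
  have hκb : (1 + (Q : ℝ) / 10 ^ 4) / 2 ≤ ((10 ^ 4 + Q : ℕ) : ℝ) / 20000 := by push_cast; linarith
  have hpq : 1 - (p : ℝ) ≤ ((Q : ℝ) / 10 ^ 4) ^ (2 * d - 1) := by
    have hQr : ((10 ^ 4 - pn : ℕ) : ℝ) * 10 ^ (4 * (2 * d - 1)) ≤ (Q : ℝ) ^ (2 * d - 1) * 10 ^ 4 := by
      exact_mod_cast hQ
    rw [Nat.cast_sub hpn] at hQr
    simp only [Nat.cast_pow, Nat.cast_ofNat] at hQr
    rw [hpc, div_pow, ← pow_mul, le_div_iff₀ (by positivity)]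
    have : (1 - (pn : ℝ) / 10 ^ 4) * 10 ^ (4 * (2 * d - 1)) = (10 ^ 4 - (pn : ℝ)) * 10 ^ (4 * (2 * d - 1)) / 10 ^ 4 := by
      ring
    rw [this, div_le_iff₀ (by positivity)]
    exact hQr
  have hvlo' : (0 : ℝ) < vlo := by exact_mod_cast hvlo
  have hlamr : (0 : ℝ) < lamN := by exact_mod_cast hlam0
  have hlam0' : (0 : ℝ) < (lamN : ℝ) / 10 ^ 5 := by positivity
  have hlam1' : (lamN : ℝ) / 10 ^ 5 < 1 := by rw [div_lt_one (by positivity)]; exact_mod_cast hlam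
  have hrowN : ∀ u : Fin (m + 1) → Fin d × Bool,
      10 ^ 5 * rowSK d m pn Q tbl dflt u ≤ lamN * denS d * vK d m tbl dflt u := by
    intro u
    obtain ⟨g, hg⟩ := exists_isNF_actW u
    have h1 := forall_of_allRange hcheck (actW g u)
    rw [nfOKS, decodeW_encW, hg, Bool.not_true, Bool.false_or, rowOKSK, decodeW_encW, decide_eq_true_eq,
      rowSK_actW, vK_actW] at h1
    exact h1
  rw [← hpc]
  refine le_siteCriticalProb_zd_of_nawRandWindowCert (m := m) ((⟨0, NeZero.pos d⟩ : Fin d), true) okN gN cN hokN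
    (fun u a _ _ => hgN u a) (fun u a _ _ => hcN u a) p (q := (Q : ℝ) / 10 ^ 4) (qb := (Q : ℝ) / 10 ^ 4)
    (κb := ((10 ^ 4 + Q : ℕ) : ℝ) / 20000) hq0 le_rfl hqb1 hκb hpq
    (fun u => (vK d m tbl dflt u : ℝ)) (vmin := vlo) (vmax := vhi) (lam := (lamN : ℝ) / 10 ^ 5) hvlo'
    (fun u => by exact_mod_cast (lookupK_bounds htbl hdflt u).1)
    (fun u => by exact_mod_cast (lookupK_bounds htbl hdflt u).2) hlam0' hlam1' fun u => ?_
  have hden : (0 : ℝ) < (denS d : ℝ) := by unfold denS; positivity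
  have hN : ((10 ^ 5 * rowSK d m pn Q tbl dflt u : ℕ) : ℝ) ≤ ((lamN * denS d * vK d m tbl dflt u : ℕ) : ℝ) := by
    exact_mod_cast hrowN u
  push_cast at hN
  have hrow : (∑ a : Fin d × Bool, if okN u a then
      (p : ℝ) * (((Q : ℝ) / 10 ^ 4) ^ gN u a * (if cN u a then ((10 ^ 4 + Q : ℕ) : ℝ) / 20000 else 1)) *
        (vK d m tbl dflt (wshift u a) : ℝ) else 0) * (denS d : ℝ) ≤ (rowSK d m pn Q tbl dflt u : ℝ) := by
    rw [rowSK, Nat.cast_sum, Finset.sum_mul]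
    refine Finset.sum_le_sum fun a _ => le_of_eq ?_
    rw [rowTermSK_eq]
    by_cases h : okN u a = true
    · simp only [h, if_true]
      rw [hpc, Nat.cast_mul, ← weightS_mul_den (gN_le u a) (cN u a), denS]
      push_cast; ring
    · simp [h]
  rw [← le_div_iff₀ hden] at hrow
  refine hrow.trans ?_
  rw [div_le_iff₀ hden]
  linarith [hN]

end WinK

end Summit.CriticalPhenomena.PercolationContinuityZ3.Theorems.Pcint
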